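import Literature.Geometry.Riemannian.BishopGromovScaled
import Literature.Geometry.Riemannian.AbreschGromollProfileHyperbolic
import Literature.Geometry.Riemannian.CyclicCoverOrbitSpace
import Mathlib.MeasureTheory.Measure.Doubling
import Mathlib.MeasureTheory.Covering.DensityTheorem
import HarnessLib

/-!
# Volume doubling under a lower Ricci bound; the Riemannian measure is uniformly locally doubling

Cheeger–Colding 1996/1997 ("by relative volume comparison … a standard covering argument"),
Gromov 1981: on a connected Riemannian `d`-manifold with complete Levi-Civita connection and
`Ric ≥ -(d-1)κ²`, the relative volume comparison (`BishopGromovScaled.lean`) gives the **volume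
doubling inequality** `Vol B_{2r}(p) ≤ 2ᵈ cosh(κ r)^{d-1} Vol B_r(p)` (all `r > 0`; we PROVE it,
`riemannianMeasure_ball_two_mul_le`, through the model identity
`∫₀^{2a} sinh^{d-1} = 2 ∫₀^a (2 sinh s cosh s)^{d-1} ds ≤ 2ᵈ cosh(a)^{d-1} ∫₀^a sinh^{d-1}`), and
hence the Riemannian measure is a **uniformly locally doubling measure** for the Riemannian
distance (`isUnifLocDoublingMeasure_riemannianMeasure`, Mathlib's `IsUnifLocDoublingMeasure`
for `g.metricSpace hg`) — the entry point to Vitali coverings, Lebesgue differentiation and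
maximal-function arguments (Mathlib `IsUnifLocDoublingMeasure.vitaliFamily`); as first
consequences, Lebesgue differentiation and Lebesgue density for the Riemannian measure
(`ae_tendsto_average_closedBall_riemannianMeasure`, `ae_tendsto_measure_inter_closedBall_div`).
No definitions, no named facts (D-0026). Groundwork for `CheegerColding1997_sphereStability`.

## References

* J. Cheeger, T. H. Colding, J. Differential Geom. 46 (1997) 406–480, (0.5)–(0.6). [CheegerColding1997]
* M. Gromov, *Metric structures for Riemannian and non-Riemannian spaces* (1999), 5.3. [Gromov1999Metric]
-/

noncomputable section

open Bundle Set Function Filter MeasureTheory Manifold Metric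
open scoped Manifold ContDiff Topology ENNReal NNReal

namespace Literature.Geometry.Riemannian

open Lorentzian Lorentzian.PseudoRiemannianMetric

/-! ### The model inequality `∫₀^{2a} sinh^{k} ≤ 2^{k+1} cosh(a)^k ∫₀^a sinh^k` -/

/-- `∫₀^{2a} sinh^k = 2 ∫₀^a sinh(2s)^k ds`. [folklore] -/
theorem integral_sinh_pow_two_mul (k : ℕ) (a : ℝ) :
    ∫ t in (0 : ℝ)..(2 * a), Real.sinh t ^ k = 2 * ∫ s in (0 : ℝ)..a, Real.sinh (2 * s) ^ k := by
  have h := intervalIntegral.integral_comp_mul_left (fun t ↦ Real.sinh t ^ k) (two_ne_zero (α := ℝ))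
    (a := 0) (b := a)
  simp only [mul_zero, smul_eq_mul] at h
  rw [h]; field_simp

/-- **The model doubling inequality**: for `a ≥ 0`,
`∫₀^{2a} sinh^k ≤ 2^{k+1} cosh(a)^k ∫₀^a sinh^k`. [folklore] -/
theorem integral_sinh_pow_two_mul_le (k : ℕ) {a : ℝ} (ha : 0 ≤ a) :
    ∫ t in (0 : ℝ)..(2 * a), Real.sinh t ^ k ≤
      2 ^ (k + 1) * Real.cosh a ^ k * ∫ s in (0 : ℝ)..a, Real.sinh s ^ k := by
  rw [integral_sinh_pow_two_mul]
  have hmono : ∫ s in (0 : ℝ)..a, Real.sinh (2 * s) ^ k ≤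
      ∫ s in (0 : ℝ)..a, (2 * Real.cosh a) ^ k * Real.sinh s ^ k := by
    refine intervalIntegral.integral_mono_on ha ?_ ?_ fun s hs ↦ ?_
    · exact (((Real.continuous_sinh.comp (continuous_const.mul continuous_id)).pow k)).intervalIntegrable _ _
    · exact ((continuous_const.mul (Real.continuous_sinh.pow k))).intervalIntegrable _ _
    · obtain ⟨hs0, hsa⟩ := hs
      rw [Real.sinh_two_mul, show 2 * Real.sinh s * Real.cosh s = (2 * Real.cosh s) * Real.sinh s by ring,
        mul_pow]
      have hsinh : 0 ≤ Real.sinh s := Real.sinh_nonneg_iff.2 hs0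
      have hcosh : Real.cosh s ≤ Real.cosh a := by
        rw [Real.cosh_le_cosh, abs_of_nonneg hs0, abs_of_nonneg ha]; exact hsa
      have h1 : (2 * Real.cosh s) ^ k ≤ (2 * Real.cosh a) ^ k :=
        pow_le_pow_left₀ (by positivity) (by linarith) k
      exact mul_le_mul_of_nonneg_right h1 (pow_nonneg hsinh k)
  rw [intervalIntegral.integral_const_mul] at hmono
  calc 2 * ∫ s in (0 : ℝ)..a, Real.sinh (2 * s) ^ k
      ≤ 2 * ((2 * Real.cosh a) ^ k * ∫ s in (0 : ℝ)..a, Real.sinh s ^ k) :=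
        mul_le_mul_of_nonneg_left hmono (by norm_num)
    _ = 2 ^ (k + 1) * Real.cosh a ^ k * ∫ s in (0 : ℝ)..a, Real.sinh s ^ k := by
        rw [mul_pow, pow_succ]; ring

/-! ### Volume doubling -/

variable {d : ℕ} {M : Type*} [TopologicalSpace M] [ChartedSpace (EuclideanSpace ℝ (Fin d)) M]
  [IsManifold 𝓘(ℝ, EuclideanSpace ℝ (Fin d)) ∞ M] [T2Space M]
  (g : PseudoRiemannianMetric 𝓘(ℝ, EuclideanSpace ℝ (Fin d)) ∞ (EuclideanSpace ℝ (Fin d))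
    (TangentSpace 𝓘(ℝ, EuclideanSpace ℝ (Fin d)) : M → Type _)) [g.HasLeviCivita]
  [CovariantDerivative.ContMDiffCovariantDerivative g.leviCivita 1]
  [CovariantDerivative.ContMDiffCovariantDerivative g.leviCivita ∞]

/-- **Volume doubling under `Ric ≥ -(d-1)κ²`** (relative volume comparison, Cheeger–Colding 1997
(0.5)–(0.6); Gromov): `Vol B_{2r}(p) ≤ 2ᵈ cosh(κ r)^{d-1} · Vol B_r(p)` for every `r > 0`.
[cite: CheegerColding1997, (0.5)–(0.6) (p. 408)] [cite: Gromov1999Metric, 5.3] -/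
theorem riemannianMeasure_ball_two_mul_le (hd : 0 < d) [ConnectedSpace M]
    [T3Space M] [MeasurableSpace M] [BorelSpace M] (hg : g.IsRiemannian)
    (hc : IsGeodesicallyComplete g.leviCivita) {κ : ℝ} (hκ : 0 < κ)
    (hRic : ∀ (x : M) (w : TangentSpace 𝓘(ℝ, (EuclideanSpace ℝ (Fin d))) x),
      -((d : ℝ) - 1) * κ ^ 2 * g.val x w w ≤ g.leviCivita.ricci x w w)
    (p : M) {r : ℝ} (hr : 0 < r) :
    riemannianMeasure (I := 𝓘(ℝ, (EuclideanSpace ℝ (Fin d)))) (g.toContMDiffRiemannianMetric hg)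
        {y : M | g.edist hg p y < ENNReal.ofReal (2 * r)} ≤
      ENNReal.ofReal (2 ^ d * Real.cosh (κ * r) ^ (d - 1)) *
        riemannianMeasure (I := 𝓘(ℝ, (EuclideanSpace ℝ (Fin d)))) (g.toContMDiffRiemannianMetric hg)
          {y : M | g.edist hg p y < ENNReal.ofReal r} := by
  have hBG := riemannianMeasure_ball_mul_le_of_ricci_ge_neg_sq g hd hg hc hκ hRic p hr
    (show r ≤ 2 * r by linarith)
  set V : ℝ := ∫ t in (0 : ℝ)..(κ * r), Real.sinh t ^ (d - 1) with hV
  have hV0 : 0 < V := primitive_sinh_pow_pos (d - 1) (mul_pos hκ hr)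
  have hmodel : ∫ t in (0 : ℝ)..(κ * (2 * r)), Real.sinh t ^ (d - 1) ≤
      2 ^ d * Real.cosh (κ * r) ^ (d - 1) * V := by
    have h := integral_sinh_pow_two_mul_le (d - 1) (mul_pos hκ hr).le
    rw [show κ * (2 * r) = 2 * (κ * r) by ring, show d = d - 1 + 1 from (Nat.sub_add_cancel hd).symm]
    simpa using h
  set μB := riemannianMeasure (I := 𝓘(ℝ, (EuclideanSpace ℝ (Fin d)))) (g.toContMDiffRiemannianMetric hg)
    {y : M | g.edist hg p y < ENNReal.ofReal (2 * r)} with hμB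
  set μb := riemannianMeasure (I := 𝓘(ℝ, (EuclideanSpace ℝ (Fin d)))) (g.toContMDiffRiemannianMetric hg)
    {y : M | g.edist hg p y < ENNReal.ofReal r} with hμb
  -- `V · μB ≤ V · (C μb)`
  have h1 : ENNReal.ofReal V * μB ≤ ENNReal.ofReal V *
      (ENNReal.ofReal (2 ^ d * Real.cosh (κ * r) ^ (d - 1)) * μb) := by
    calc ENNReal.ofReal V * μB = μB * ENNReal.ofReal V := mul_comm _ _
      _ ≤ μb * ENNReal.ofReal (∫ t in (0 : ℝ)..(κ * (2 * r)), Real.sinh t ^ (d - 1)) := hBG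
      _ ≤ μb * ENNReal.ofReal (2 ^ d * Real.cosh (κ * r) ^ (d - 1) * V) :=
          mul_le_mul_of_nonneg_left (ENNReal.ofReal_le_ofReal hmodel) (zero_le)
      _ = ENNReal.ofReal V * (ENNReal.ofReal (2 ^ d * Real.cosh (κ * r) ^ (d - 1)) * μb) := by
          rw [ENNReal.ofReal_mul (by positivity)]; ring
  have hVpos : ENNReal.ofReal V ≠ 0 := (ENNReal.ofReal_pos.2 hV0).ne'
  exact (ENNReal.mul_le_mul_iff_right hVpos ENNReal.ofReal_ne_top).1 h1

/-- **The Riemannian measure is uniformly locally doubling** for the Riemannian distance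
(`g.metricSpace hg`) on a connected Riemannian manifold with complete Levi-Civita connection
and `Ric ≥ -(d-1)κ²`: Mathlib's `IsUnifLocDoublingMeasure`, with closed balls compared through
`closedBall x (2ε) ⊆ B_{4ε}(x)` and two volume doublings (`ε ≤ 1`).
[cite: CheegerColding1997, (0.5)–(0.6) (p. 408)] [cite: Gromov1999Metric, 5.3] -/
theorem isUnifLocDoublingMeasure_riemannianMeasure (hd : 0 < d) [ConnectedSpace M]
    [T3Space M] [MeasurableSpace M] [BorelSpace M] (hg : g.IsRiemannian)
    (hc : IsGeodesicallyComplete g.leviCivita) {κ : ℝ} (hκ : 0 < κ)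
    (hRic : ∀ (x : M) (w : TangentSpace 𝓘(ℝ, (EuclideanSpace ℝ (Fin d))) x),
      -((d : ℝ) - 1) * κ ^ 2 * g.val x w w ≤ g.leviCivita.ricci x w w) :
    @IsUnifLocDoublingMeasure M (g.metricSpace hg).toPseudoMetricSpace _
      (riemannianMeasure (I := 𝓘(ℝ, (EuclideanSpace ℝ (Fin d)))) (g.toContMDiffRiemannianMetric hg)) := by
  letI := g.metricSpace hg
  set μ := riemannianMeasure (I := 𝓘(ℝ, (EuclideanSpace ℝ (Fin d)))) (g.toContMDiffRiemannianMetric hg)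
    with hμ
  -- the doubling constant at scales `≤ 1`
  set C : ℝ := 2 ^ d * Real.cosh (κ * 2) ^ (d - 1) with hC
  have hC1 : 1 ≤ C := by
    rw [hC]
    have h1 : (1 : ℝ) ≤ 2 ^ d := one_le_pow₀ (by norm_num)
    have h2 : (1 : ℝ) ≤ Real.cosh (κ * 2) ^ (d - 1) := one_le_pow₀ (Real.one_le_cosh _)
    nlinarith
  have hdoub : ∀ (x : M) {s : ℝ}, 0 < s → s ≤ 2 →
      μ {y : M | g.edist hg x y < ENNReal.ofReal (2 * s)} ≤
        ENNReal.ofReal C * μ {y : M | g.edist hg x y < ENNReal.ofReal s} := by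
    intro x s hs hs2
    refine (riemannianMeasure_ball_two_mul_le g hd hg hc hκ hRic x hs).trans ?_
    refine mul_le_mul_of_nonneg_right (ENNReal.ofReal_le_ofReal ?_) (zero_le)
    rw [hC]
    refine mul_le_mul_of_nonneg_left (pow_le_pow_left₀ (Real.cosh_pos _).le ?_ _) (by positivity)
    rw [Real.cosh_le_cosh, abs_of_pos (mul_pos hκ hs), abs_of_pos (by positivity)]
    exact mul_le_mul_of_nonneg_left hs2 hκ.le
  refine ⟨⟨(C ^ 2).toNNReal, ?_⟩⟩
  have hev : ∀ᶠ ε in 𝓝[>] (0 : ℝ), 0 < ε ∧ ε ≤ 1 := by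
    filter_upwards [self_mem_nhdsWithin, Ioc_mem_nhdsGT (zero_lt_one' ℝ)] with ε hε hε'
    exact ⟨hε, hε'.2⟩
  filter_upwards [hev] with ε hε x
  obtain ⟨hε0, hε1⟩ := hε
  -- `closedBall x (2ε) ⊆ B_{4ε}`, `B_ε ⊆ closedBall x ε`
  have hsub1 : closedBall x (2 * ε) ⊆ {y : M | g.edist hg x y < ENNReal.ofReal (2 * (2 * ε))} := by
    intro y hy
    rw [mem_closedBall, dist_comm, PseudoRiemannianMetric.metricSpace_dist hg] at hy
    simp only [mem_setOf_eq]
    rw [← ENNReal.ofReal_toReal (edist_ne_top hg x y)]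
    exact (ENNReal.ofReal_lt_ofReal_iff (by positivity)).2 (by linarith)
  have hsub2 : {y : M | g.edist hg x y < ENNReal.ofReal ε} ⊆ closedBall x ε := by
    intro y hy
    simp only [mem_setOf_eq] at hy
    rw [mem_closedBall, dist_comm, PseudoRiemannianMetric.metricSpace_dist hg]
    have := (ENNReal.lt_ofReal_iff_toReal_lt (edist_ne_top hg x y)).1 hy
    exact this.le
  have h1 := hdoub x (show 0 < 2 * ε by positivity) (by linarith)
  have h2 := hdoub x hε0 (by linarith)
  have hC0 : 0 ≤ C := by linarith
  calc μ (closedBall x (2 * ε)) ≤ μ {y : M | g.edist hg x y < ENNReal.ofReal (2 * (2 * ε))} :=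
        measure_mono hsub1
    _ ≤ ENNReal.ofReal C * (ENNReal.ofReal C * μ {y : M | g.edist hg x y < ENNReal.ofReal ε}) :=
        h1.trans (mul_le_mul_of_nonneg_left h2 (zero_le))
    _ = ENNReal.ofReal (C ^ 2) * μ {y : M | g.edist hg x y < ENNReal.ofReal ε} := by
        rw [← mul_assoc, ← ENNReal.ofReal_mul hC0, pow_two]
    _ ≤ ((C ^ 2).toNNReal : ℝ≥0∞) * μ (closedBall x ε) := by
        rw [ENNReal.ofReal]
        exact mul_le_mul_of_nonneg_left (measure_mono hsub2) (zero_le)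

/-! ### Lebesgue differentiation for the Riemannian measure -/

/-- **Lebesgue's differentiation theorem on a Riemannian manifold with `Ric ≥ -(d-1)κ²`**
(through `isUnifLocDoublingMeasure_riemannianMeasure` and Mathlib's
`IsUnifLocDoublingMeasure.ae_tendsto_average`): for a locally integrable `f`, at almost every
`x` the averages of `f` over the closed distance balls `B̄_r(x)` converge to `f x` as `r → 0⁺`.
[cite: CheegerColding1997, (0.5)–(0.6) (p. 408)] -/
theorem ae_tendsto_average_closedBall_riemannianMeasure (hd : 0 < d) [ConnectedSpace M]
    [T3Space M] [SecondCountableTopology M] [MeasurableSpace M] [BorelSpace M] (hg : g.IsRiemannian)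
    (hc : IsGeodesicallyComplete g.leviCivita) {κ : ℝ} (hκ : 0 < κ)
    (hRic : ∀ (x : M) (w : TangentSpace 𝓘(ℝ, (EuclideanSpace ℝ (Fin d))) x),
      -((d : ℝ) - 1) * κ ^ 2 * g.val x w w ≤ g.leviCivita.ricci x w w)
    {f : M → ℝ}
    (hf : LocallyIntegrable f
      (riemannianMeasure (I := 𝓘(ℝ, (EuclideanSpace ℝ (Fin d)))) (g.toContMDiffRiemannianMetric hg))) :
    letI := g.metricSpace hg
    ∀ᵐ x ∂(riemannianMeasure (I := 𝓘(ℝ, (EuclideanSpace ℝ (Fin d)))) (g.toContMDiffRiemannianMetric hg)),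
      Tendsto (fun r : ℝ ↦ ⨍ y in closedBall x r, f y
        ∂(riemannianMeasure (I := 𝓘(ℝ, (EuclideanSpace ℝ (Fin d)))) (g.toContMDiffRiemannianMetric hg)))
        (𝓝[>] 0) (𝓝 (f x)) := by
  letI := g.metricSpace hg
  set μ := riemannianMeasure (I := 𝓘(ℝ, (EuclideanSpace ℝ (Fin d)))) (g.toContMDiffRiemannianMetric hg)
    with hμ
  haveI : LocallyCompactSpace M := Manifold.locallyCompact_of_finiteDimensional 𝓘(ℝ, EuclideanSpace ℝ (Fin d))
  haveI : IsUnifLocDoublingMeasure μ := isUnifLocDoublingMeasure_riemannianMeasure g hd hg hc hκ hRic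
  haveI : IsFiniteMeasureOnCompacts μ :=
    ⟨fun K hK ↦ riemannianVolume_lt_top_of_isCompact_holds (g.toContMDiffRiemannianMetric hg)
      (by rw [finrank_euclideanSpace_fin]) hK⟩
  haveI : IsLocallyFiniteMeasure μ := inferInstance
  filter_upwards [IsUnifLocDoublingMeasure.ae_tendsto_average μ hf 1] with x hx
  refine hx (fun _ ↦ x) id tendsto_id ?_
  filter_upwards [self_mem_nhdsWithin] with r hr
  rw [one_mul, id]
  exact mem_closedBall_self (le_of_lt hr)

/-- **Lebesgue density of measurable sets** on a Riemannian manifold with `Ric ≥ -(d-1)κ²`: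
for a set `S`, at almost every point of `S` the relative measure `μ(S ∩ B̄_r(x))/μ(B̄_r(x))`
tends to `1` as `r → 0⁺` (Mathlib's `IsUnifLocDoublingMeasure.ae_tendsto_measure_inter_div`).
[cite: CheegerColding1997, (0.5)–(0.6) (p. 408)] -/
theorem ae_tendsto_measure_inter_closedBall_div (hd : 0 < d) [ConnectedSpace M]
    [T3Space M] [SecondCountableTopology M] [MeasurableSpace M] [BorelSpace M] (hg : g.IsRiemannian)
    (hc : IsGeodesicallyComplete g.leviCivita) {κ : ℝ} (hκ : 0 < κ)
    (hRic : ∀ (x : M) (w : TangentSpace 𝓘(ℝ, (EuclideanSpace ℝ (Fin d))) x),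
      -((d : ℝ) - 1) * κ ^ 2 * g.val x w w ≤ g.leviCivita.ricci x w w)
    (S : Set M) :
    letI := g.metricSpace hg
    ∀ᵐ x ∂(riemannianMeasure (I := 𝓘(ℝ, (EuclideanSpace ℝ (Fin d)))) (g.toContMDiffRiemannianMetric hg)).restrict S,
      Tendsto (fun r : ℝ ↦
        riemannianMeasure (I := 𝓘(ℝ, (EuclideanSpace ℝ (Fin d)))) (g.toContMDiffRiemannianMetric hg)
            (S ∩ closedBall x r) /
          riemannianMeasure (I := 𝓘(ℝ, (EuclideanSpace ℝ (Fin d)))) (g.toContMDiffRiemannianMetric hg)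
            (closedBall x r)) (𝓝[>] 0) (𝓝 1) := by
  letI := g.metricSpace hg
  set μ := riemannianMeasure (I := 𝓘(ℝ, (EuclideanSpace ℝ (Fin d)))) (g.toContMDiffRiemannianMetric hg)
    with hμ
  haveI : LocallyCompactSpace M := Manifold.locallyCompact_of_finiteDimensional 𝓘(ℝ, EuclideanSpace ℝ (Fin d))
  haveI : IsUnifLocDoublingMeasure μ := isUnifLocDoublingMeasure_riemannianMeasure g hd hg hc hκ hRic
  haveI : IsFiniteMeasureOnCompacts μ :=
    ⟨fun K hK ↦ riemannianVolume_lt_top_of_isCompact_holds (g.toContMDiffRiemannianMetric hg)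
      (by rw [finrank_euclideanSpace_fin]) hK⟩
  haveI : IsLocallyFiniteMeasure μ := inferInstance
  filter_upwards [IsUnifLocDoublingMeasure.ae_tendsto_measure_inter_div μ S 1] with x hx
  refine hx (fun _ ↦ x) id tendsto_id ?_
  filter_upwards [self_mem_nhdsWithin] with r hr
  rw [one_mul, id]
  exact mem_closedBall_self (le_of_lt hr)

end Literature.Geometry.Riemannian

end
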